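import Summits.AtomisticToContinuum.Crystallization.Theorems.FrustratedLawDichotomyCellTailsRem
import Summits.AtomisticToContinuum.Crystallization.Theorems.FrustratedLawDichotomyCellClasses

/-!
# FrustratedLawDichotomy · crux `AperiodicFrustratedLawGap` (stmt-AtomisticToContinuum-27623) — CELL-ARITH companion: THE FAR-LABEL SIDE
# CONDITIONS OF THE (251) MASTER UNDER LABELS-SCALE (decomp-a2c hand-1 g54; crit r1809 mechanics of record)

Two hypotheses of (251) `…CellTailsRem.lb_le_certFloorL_trunc` quantify over ALL template labels and are NOT vacuous at F1 scale
(`|M| ≈ 14 000`, `|MN| ≈ 900`, list-backed `M` never evaluated):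
`hMNc : ∀ m ∈ M.erase o, m ∉ MN → R_N ≤ ‖pos m‖ ∧ m ∉ MI ∧ ∀ x ∈ MI, x ∉ nb m` and `hMLc : ∀ m ∈ M.erase o, m ∉ ML → L_D ≤ ‖pos m‖`.
With the lists of record — `MN ⊇ {m ≠ o : |z m|² < ℓ_N}` and `ML ⊇ {m ≠ o : |z m|² < ℓ_D}` BY PREDICATE, `nb := ballL M z ℓ_n`,
`MI ⊆ {|z x|² < ℓ_A}` — both follow from PURE LABEL ARITHMETIC plus the caller's metric conversion
(`ℓ ≤ |z m|² ⇒ L ≤ ‖pos m‖`: (261) `le_norm_of_intRadius` for `h•z`, (270) `le_norm_of_linRadius` for `T *ᵥ z`):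

* ★ `sumSq_add_lt` — the sqrt-free integer triangle inequality `|u|² < A², |v|² < B² ⇒ |u + v|² < (A + B)²` (Cauchy–Schwarz on `Fin 3`);
* ★ `not_mem_ballL_of_far` — `|z x|² < ℓ_A ≤ A²`, `ℓ_N ≤ |z m|²`, `(A + B)² ≤ ℓ_N`, `ℓ_n ≤ B²` ⇒ `x ∉ ballL M z ℓ_n m`;
* ★★ `hMNc_of_radii` — `hMNc` VERBATIM; ★ `hMLc_of_radius` — `hMLc` VERBATIM.
The rational radii `A, B` and the four inequalities are ONE `decide`/`norm_num` each (F1 at L_N 3: `ℓ_A, ℓ_n, ℓ_N` from the census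
`ellQ` thresholds).  DEF-FREE; imports TREE (251) `…CellTailsRem` and (261) `…CellClasses`; 0 sorry.  All `[folklore]`.
-/

noncomputable section

namespace Summit.AtomisticToContinuum.Crystallization.Theorems.FrustratedLawDichotomyCellFarLabels

open Metric Set
open scoped BigOperators
open Summit.AtomisticToContinuum.Crystallization.Theorems.ChargedEnergyGapNegative (E3)
open Summit.AtomisticToContinuum.Crystallization.Theorems.FrustratedLawDichotomyCellClasses (ballL)

variable {ι : Type*} [DecidableEq ι]

/-! ## §1. Label arithmetic -/

omit [DecidableEq ι] in
/-- ★ THE SQRT-FREE TRIANGLE INEQUALITY: `|u|² < A²`, `|v|² < B²`, `0 ≤ A, B` ⇒ `|u + v|² < (A + B)²`. [folklore] -/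
theorem sumSq_add_lt {u v : Fin 3 → ℝ} {A B : ℝ} (hA : 0 ≤ A) (hB : 0 ≤ B) (hu : ∑ i, u i ^ 2 < A ^ 2) (hv : ∑ i, v i ^ 2 < B ^ 2) :
    ∑ i, (u i + v i) ^ 2 < (A + B) ^ 2 := by
  -- Cauchy–Schwarz on the three coordinates (Mathlib `Finset.sum_mul_sq_le_sq_mul_sq`)
  have hcs : (∑ i, u i * v i) ^ 2 ≤ (∑ i, u i ^ 2) * ∑ i, v i ^ 2 := Finset.sum_mul_sq_le_sq_mul_sq Finset.univ u v
  have hu0 : 0 ≤ ∑ i, u i ^ 2 := Finset.sum_nonneg fun i _ => sq_nonneg _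
  have hv0 : 0 ≤ ∑ i, v i ^ 2 := Finset.sum_nonneg fun i _ => sq_nonneg _
  -- the mixed term is at most `A·B`
  have hprod : (∑ i, u i ^ 2) * ∑ i, v i ^ 2 ≤ A ^ 2 * B ^ 2 :=
    mul_le_mul hu.le hv.le hv0 (sq_nonneg _)
  have hS : ∑ i, u i * v i ≤ A * B := by
    by_contra h
    push Not at h
    have hAB : 0 ≤ A * B := mul_nonneg hA hB
    have h2 : (A * B) ^ 2 < (∑ i, u i * v i) ^ 2 := by
      exact pow_lt_pow_left₀ h hAB two_ne_zero
    nlinarith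
  have e : ∑ i, (u i + v i) ^ 2 = ∑ i, u i ^ 2 + 2 * ∑ i, u i * v i + ∑ i, v i ^ 2 := by
    simp only [add_sq, Finset.sum_add_distrib, Finset.mul_sum]
    ring_nf
  rw [e]
  nlinarith

omit [DecidableEq ι] in
/-- integer form: `Σ (zx)² < ℓA ≤ A²`, `Σ (zm − zx)² < ℓn ≤ B²`, `(A + B)² ≤ ℓN` ⇒ `Σ (zm)² < ℓN`. [folklore] -/
theorem sumSq_lt_of_near {zx zm : Fin 3 → ℤ} {ℓA ℓn ℓN : ℤ} {A B : ℚ} (h0A : 0 ≤ A) (h0B : 0 ≤ B)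
    (hA : (ℓA : ℚ) ≤ A ^ 2) (hB : (ℓn : ℚ) ≤ B ^ 2) (hAB : (A + B) ^ 2 ≤ (ℓN : ℚ))
    (hx : ∑ i, zx i ^ 2 < ℓA) (hxm : ∑ i, (zx i - zm i) ^ 2 < ℓn) : ∑ i, zm i ^ 2 < ℓN := by
  have hu : ∑ i, ((zx i : ℤ) : ℝ) ^ 2 < ((A : ℚ) : ℝ) ^ 2 := by
    have h1 : ((∑ i, zx i ^ 2 : ℤ) : ℝ) < ((ℓA : ℤ) : ℝ) := by exact_mod_cast hx
    have h2 : ((ℓA : ℚ) : ℝ) ≤ ((A ^ 2 : ℚ) : ℝ) := by exact_mod_cast hA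
    push_cast at h1 h2 ⊢
    linarith
  have hv : ∑ i, (((zm i - zx i : ℤ)) : ℝ) ^ 2 < ((B : ℚ) : ℝ) ^ 2 := by
    have e : ∑ i, (zm i - zx i) ^ 2 = ∑ i, (zx i - zm i) ^ 2 := Finset.sum_congr rfl fun i _ => by ring
    have h1 : ((∑ i, (zm i - zx i) ^ 2 : ℤ) : ℝ) < ((ℓn : ℤ) : ℝ) := by rw [e]; exact_mod_cast hxm
    have h2 : ((ℓn : ℚ) : ℝ) ≤ ((B ^ 2 : ℚ) : ℝ) := by exact_mod_cast hB
    push_cast at h1 h2 ⊢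
    linarith
  have h := sumSq_add_lt (u := fun i => ((zx i : ℤ) : ℝ)) (v := fun i => (((zm i - zx i : ℤ)) : ℝ))
    (by exact_mod_cast h0A) (by exact_mod_cast h0B) hu hv
  have e : ∀ i, ((zx i : ℤ) : ℝ) + (((zm i - zx i : ℤ)) : ℝ) = ((zm i : ℤ) : ℝ) := by intro i; push_cast; ring
  simp only [e] at h
  have h3 : (((A + B) ^ 2 : ℚ) : ℝ) ≤ ((ℓN : ℚ) : ℝ) := by exact_mod_cast hAB
  have h4 : ((∑ i, zm i ^ 2 : ℤ) : ℝ) < ((ℓN : ℤ) : ℝ) := by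
    push_cast at h h3 ⊢
    linarith
  exact_mod_cast h4

omit [DecidableEq ι] in
/-- ★ an interior label (`|z x|² < ℓ_A`) is NOT in the `ℓ_n`-list of a far label (`ℓ_N ≤ |z m|²`) once `(A + B)² ≤ ℓ_N`,
`ℓ_A ≤ A²`, `ℓ_n ≤ B²`. [folklore] -/
theorem not_mem_ballL_of_far {M : Finset ι} {z : ι → Fin 3 → ℤ} {ℓA ℓn ℓN : ℤ} {A B : ℚ} (h0A : 0 ≤ A) (h0B : 0 ≤ B)
    (hA : (ℓA : ℚ) ≤ A ^ 2) (hB : (ℓn : ℚ) ≤ B ^ 2) (hAB : (A + B) ^ 2 ≤ (ℓN : ℚ)) {x m : ι}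
    (hx : ∑ i, z x i ^ 2 < ℓA) (hm : ℓN ≤ ∑ i, z m i ^ 2) : x ∉ ballL M z ℓn m := by
  intro hxn
  have hxm : ∑ i, (z x i - z m i) ^ 2 < ℓn := (Finset.mem_filter.mp hxn).2
  have := sumSq_lt_of_near h0A h0B hA hB hAB hx hxm
  omega

/-! ## §2. The two far-label hypotheses of the master, verbatim -/

section Master

variable {M MI : Finset ι} {pos : ι → E3} {z : ι → Fin 3 → ℤ}

/-- outside a predicate-superset list the integer squared norm is `≥ ℓ`. [folklore] -/
theorem far_of_not_mem {o : ι} {L : Finset ι} {ℓ : ℤ} (hsup : ∀ m ∈ M, m ≠ o → ∑ i, z m i ^ 2 < ℓ → m ∈ L)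
    {m : ι} (hm : m ∈ M.erase o) (hmL : m ∉ L) : ℓ ≤ ∑ i, z m i ^ 2 := by
  obtain ⟨hne, hmM⟩ := Finset.mem_erase.mp hm
  by_contra hlt
  exact hmL (hsup m hmM hne (lt_of_not_ge hlt))

/-- ★★ **`hMNc` OF (251) VERBATIM.**  NASH near list `MN ⊇ {m ∈ M ∖ o : |z m|² < ℓ_N}` (by predicate), near bonds `nb := ballL M z ℓ_n`,
interior inside `|z x|² < ℓ_A`, `ℓ_A ≤ ℓ_N`, rational radii with `ℓ_A ≤ A²`, `ℓ_n ≤ B²`, `(A + B)² ≤ ℓ_N`, and the caller's metric conversion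
`ℓ_N ≤ |z m|² ⇒ R_N ≤ ‖pos m‖` ((261) `le_norm_of_intRadius` / (270) `le_norm_of_linRadius` on the cell). [folklore] -/
theorem hMNc_of_radii (o : ι) {MN : Finset ι} {ℓA ℓn ℓN : ℤ} {A B : ℚ} {R_N : ℝ}
    (hMNsup : ∀ m ∈ M, m ≠ o → ∑ i, z m i ^ 2 < ℓN → m ∈ MN) (hMIA : ∀ x ∈ MI, ∑ i, z x i ^ 2 < ℓA) (hAN : ℓA ≤ ℓN)
    (h0A : 0 ≤ A) (h0B : 0 ≤ B) (hA : (ℓA : ℚ) ≤ A ^ 2) (hB : (ℓn : ℚ) ≤ B ^ 2) (hAB : (A + B) ^ 2 ≤ (ℓN : ℚ))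
    (hfar : ∀ m ∈ M, ℓN ≤ ∑ i, z m i ^ 2 → R_N ≤ ‖pos m‖) :
    ∀ m ∈ M.erase o, m ∉ MN → R_N ≤ ‖pos m‖ ∧ m ∉ MI ∧ ∀ x ∈ MI, x ∉ ballL M z ℓn m := by
  intro m hm hmN
  have hfarm : ℓN ≤ ∑ i, z m i ^ 2 := far_of_not_mem hMNsup hm hmN
  refine ⟨hfar m (Finset.mem_of_mem_erase hm) hfarm, fun hmI => ?_, fun x hx => ?_⟩
  · have := hMIA m hmI
    omega
  · exact not_mem_ballL_of_far h0A h0B hA hB hAB (hMIA x hx) hfarm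

/-- ★ **`hMLc` OF (251) VERBATIM.**  Debit list `ML ⊇ {m ∈ M ∖ o : |z m|² < ℓ_D}` (by predicate) and the caller's conversion
`ℓ_D ≤ |z m|² ⇒ L_D ≤ ‖pos m‖`. [folklore] -/
theorem hMLc_of_radius (o : ι) {ML : Finset ι} {ℓD : ℤ} {L_D : ℝ}
    (hMLsup : ∀ m ∈ M, m ≠ o → ∑ i, z m i ^ 2 < ℓD → m ∈ ML) (hfar : ∀ m ∈ M, ℓD ≤ ∑ i, z m i ^ 2 → L_D ≤ ‖pos m‖) :
    ∀ m ∈ M.erase o, m ∉ ML → L_D ≤ ‖pos m‖ :=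
  fun m hm hmL => hfar m (Finset.mem_of_mem_erase hm) (far_of_not_mem hMLsup hm hmL)

/-- the predicate-superset hypothesis for the list OF RECORD `(ballL M z ℓ o).erase o` itself (root at `z o = 0`). [folklore] -/
theorem sup_of_ballL_erase (o : ι) (hz0 : z o = 0) (ℓ : ℤ) :
    ∀ m ∈ M, m ≠ o → ∑ i, z m i ^ 2 < ℓ → m ∈ (ballL M z ℓ o).erase o := by
  intro m hm hne hlt
  refine Finset.mem_erase.mpr ⟨hne, Finset.mem_filter.mpr ⟨hm, ?_⟩⟩
  simpa [hz0] using hlt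

omit [DecidableEq ι] in
/-- the interior-radius hypothesis from the interior list OF RECORD `MI ⊆ ballL M z ℓ_A o` (root at `z o = 0`). [folklore] -/
theorem hMIA_of_ballL (o : ι) (hz0 : z o = 0) {ℓA : ℤ} (hMI : MI ⊆ ballL M z ℓA o) :
    ∀ x ∈ MI, ∑ i, z x i ^ 2 < ℓA := by
  intro x hx
  have h := (Finset.mem_filter.mp (hMI hx)).2
  simpa [hz0] using h

end Master

end Summit.AtomisticToContinuum.Crystallization.Theorems.FrustratedLawDichotomyCellFarLabels

end
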